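import Mathlib
import Summits.Ventures.HodgeRepro.Tier4.Line4.ProductWitness
import Summits.Ventures.HodgeRepro.Tier4.Line4.LevelVolume
import Summits.Ventures.HodgeRepro.Tier4.Line4.LevelVolumeAlong
import Summits.Ventures.HodgeRepro.Tier4.Line4.L1ClassV4

/-!
# Tier4/Line4/NaturalWitness — C-L4-NATWITNESS: the natural level family `(ffinLevel N, e ⊗ 1_{K(N)})` is a
`TailFamily'` (modulo the `l1` display of LevelVolume)

Blind re-derivation cell `pub-hodge-repro`, Tier 4 «prove the step» (README §9–§10), seat t4-L1-p1 (prover, LINE L1,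
gen 4; self-cut S15189 after C-L4-ARCHAPPROX / C-L4-PRODWITNESS).  Tree path
`lean/Summits/Ventures/HodgeRepro/Tier4/Line4/NaturalWitness.lean`.  Mathlib-level; no literature.

WHAT IS PROVED (every declaration sorry-free, axioms `[propext, Classical.choice, Quot.sound]`).
* the `ffin`-side laws of L2-p1's `ffinLevel N = levelNorm⁻¹ · 1[x_f ∈ K(N) γ₀,f K(N)]`: `isFinFactor_ffinLevel (hN : N ≠ 0)`
  (support inside the compact double coset, read in `G(𝔸_f)` through the closed embedding `finitePart ↪ G(𝔸)`),
  `ffinLevel_inv_mul_of_mem (hκ : κ ∈ K(N))` (left `K(N)`-invariance, the `leftInv` clause),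
  `exists_levelK_mul_of_ffinLevel_ne_zero` (the `suppFin` clause: the set product `K(N) · {γ₀,f} · K(N)` unpacked).
* `ffinNat νf νf' γ₀ lev N := if N ≠ 0 ∧ ∃ n, lev n = N then ffinLevel W νf νf' γ₀ N else 0` — the natural finite
  factor family SUPPORTED ON THE RANGE OF THE LEVEL SEQUENCE `lev` (crit-1 S15195 (1), plan-4 S15199: the all-`N`
  family would bind the all-`N` `LevelVolumeComparison`, expected FALSE (O-L4-LEVELVOL); along `q^n` the `l1` clause
  is the honest ALONG display) and `0` elsewhere, in particular at level `0` (`K(0) = {1}` is not open); `testNat e N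
  := if N = 0 then 0 else prodFn W e (levelInd W N)` — the natural second test family (every clause of `TailFamily'`
  is trivial at the value `0`, and v0.35's display uses only the levels `lev n ≠ 0`).
* **`tailFamily'_natural`**: for `e` an archimedean test factor (`IsInfFactor`) with the right-`(T′_w, −e′)`-equivariance
  ArchApprox's `exists_infFactor_weightEquivariant_archFactor_convInf_ne_zero` delivers, and the `l1` clause of
  `ffinLevel` ALONG `lev` (`hl1`: for every Haar measure of `G(𝔸_f)` a bound `M₁` on `∫ ‖ffinLevel (lev n)‖`, uniform
  in `n`), `L1Class.TailFamily' W q g g' eP' eM' γ₀ (ffinNat W νf νf' γ₀ lev) (testNat W e)`; the corollary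
  `tailFamily'_natural_of_levelVolumeComparisonAlong` takes the `l1` clause along `lev n = p ^ n` from L2-p1's
  `LevelVolumeComparisonAlong` display through `integral_norm_ffinLevel_le_along`.

HONEST SCOPE: this is the FAMILY of `TailForArch'''` (v0.35/v0.36) on the tree modulo ONE display (`l1` =
LevelVolumeAlong's `LevelVolumeComparisonAlong`, a local-volume count along `p^n`); nothing here touches the tail
estimate itself ((R-30)–(R-32): the fibre / level-measure analysis).  Junk: off the range of `lev` and at `N = 0` both
families are `0` and every clause is trivial; `e = 0` is fine.

Nothing here says anything about the status of the Hodge conjecture for CM abelian varieties, which is NOT proved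
(HC_CM is NOT proved by anyone in this repository).
-/

set_option autoImplicit false
noncomputable section
namespace Summit.Ventures.HodgeRepro.Tier4.Line4
open Summit.Ventures.HodgeRepro.Tier4 Summit.Ventures.HodgeRepro.Tier4.Common Summit.Ventures.HodgeRepro.Tier4.Line1
  Summit.Ventures.HodgeRepro.Tier4.Line4.L1Class MeasureTheory NumberField
open scoped ComplexConjugate Topology Pointwise

section NaturalWitness

variable {k : Type} [Field k] [NumberField k] (W : PlaneData k) [MeasurableSpace (GA W)] [BorelSpace (GA W)]
  (νf : Measure (torusFin W)) (νf' : Measure (torusFin' W)) (γ₀ : GA W)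

/-! ### The `ffin`-side laws of `ffinLevel` -/

omit [MeasurableSpace (GA W)] [BorelSpace (GA W)] in
/-- the double coset `K(N) γ₀,f K(N)` lies in `G(𝔸_f)`. -/
theorem levelDoubleCoset_subset_finitePart (N : ℕ) :
    levelDoubleCoset W N (GA.ofFinPart W γ₀) ⊆ (finitePart W : Set (GA W)) := by
  intro g hg
  obtain ⟨a, ha, c, hc, rfl⟩ := exists_eq_mul_of_mem_mul_singleton_mul W _ _ g hg
  exact (finitePart W).mul_mem ((finitePart W).mul_mem (levelK_le_finitePart W N ha)
    (ofFinPart_mem_finitePart W γ₀)) (levelK_le_finitePart W N hc)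

omit [BorelSpace (GA W)] in
/-- **`ffinLevel N` is a compactly supported finite factor** for `N ≠ 0`. -/
theorem isFinFactor_ffinLevel {N : ℕ} (hN : N ≠ 0) : IsFinFactor W (ffinLevel W νf νf' γ₀ N) := by
  haveI : T2Space (GA W) := t2Space_GA W
  refine ⟨continuous_ffinLevel W νf νf' γ₀ N hN, fun x => (ffinLevel_ofFinPart W νf νf' γ₀ N x).symm, ?_⟩
  have hemb : Topology.IsClosedEmbedding (Subtype.val : finitePart W → GA W) :=
    Topology.IsClosedEmbedding.subtypeVal (isClosed_finitePart W)
  have hK : IsCompact ((Subtype.val : finitePart W → GA W) ⁻¹' levelDoubleCoset W N (GA.ofFinPart W γ₀)) :=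
    hemb.isCompact_preimage (isCompact_levelDoubleCoset W hN _)
  refine HasCompactSupport.intro hK fun y hy => ?_
  by_contra hne
  exact hy (mem_levelDoubleCoset_of_ffinLevel_ne_zero W νf νf' γ₀ N y.2 hne)

omit [BorelSpace (GA W)] in
/-- **left `K(N)`-invariance of `ffinLevel N`** (the `leftInv` clause). -/
theorem ffinLevel_inv_mul_of_mem {N : ℕ} {κ : GA W} (hκ : κ ∈ levelK W N) (x : GA W) :
    ffinLevel W νf νf' γ₀ N (κ⁻¹ * x) = ffinLevel W νf νf' γ₀ N x := by
  have hκf : κ ∈ finitePart W := levelK_le_finitePart W N hκ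
  have hfin : GA.ofFinPart W (κ⁻¹ * x) = κ⁻¹ * GA.ofFinPart W x := by
    rw [ofFinPart_mul, ofFinPart_inv, ofFinPart_eq_self_of_mem_finitePart W hκf]
  unfold ffinLevel
  rw [hfin]
  congr 1
  by_cases h : GA.ofFinPart W x ∈ levelDoubleCoset W N (GA.ofFinPart W γ₀)
  · rw [Set.indicator_of_mem h, Set.indicator_of_mem]
    obtain ⟨a, ha, c, hc, hac⟩ := exists_eq_mul_of_mem_mul_singleton_mul W _ _ _ h
    rw [hac, ← mul_assoc, ← mul_assoc]
    exact Set.mul_mem_mul (Set.mul_mem_mul ((levelK W N).mul_mem ((levelK W N).inv_mem hκ) ha)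
      (Set.mem_singleton _)) hc
  · rw [Set.indicator_of_notMem h, Set.indicator_of_notMem]
    intro h'
    apply h
    obtain ⟨a, ha, c, hc, hac⟩ := exists_eq_mul_of_mem_mul_singleton_mul W _ _ _ h'
    have hac' : κ⁻¹ * GA.ofFinPart W x = a * (GA.ofFinPart W γ₀ * c) := by rw [hac, mul_assoc]
    have : GA.ofFinPart W x = (κ * a) * GA.ofFinPart W γ₀ * c := by
      rw [mul_assoc (κ * a), mul_assoc κ, ← hac', mul_inv_cancel_left]
    rw [this]
    exact Set.mul_mem_mul (Set.mul_mem_mul ((levelK W N).mul_mem hκ ha) (Set.mem_singleton _)) hc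

omit [BorelSpace (GA W)] in
/-- **the `suppFin` clause for `ffinLevel N`**: where it does not vanish, `x_f ∈ K(N) γ₀,f K(N)`. -/
theorem exists_levelK_mul_of_ffinLevel_ne_zero {N : ℕ} {x : GA W} (h : ffinLevel W νf νf' γ₀ N x ≠ 0) :
    ∃ κ₁ ∈ levelK W N, ∃ κ₂ ∈ levelK W N, GA.ofFinPart W x = κ₁ * GA.ofFinPart W γ₀ * κ₂ := by
  have h' : ffinLevel W νf νf' γ₀ N (GA.ofFinPart W x) ≠ 0 := by
    rwa [ffinLevel_ofFinPart]
  have hmem := mem_levelDoubleCoset_of_ffinLevel_ne_zero W νf νf' γ₀ N (ofFinPart_mem_finitePart W x) h'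
  obtain ⟨a, ha, c, hc, hac⟩ := exists_eq_mul_of_mem_mul_singleton_mul W _ _ _ hmem
  exact ⟨a, ha, c, hc, hac⟩

/-! ### The natural witness family -/

omit [BorelSpace (GA W)] in
/-- **the natural finite factor family along a level sequence**: `ffinLevel N` at the levels `N = lev n ≠ 0` actually
used, and `0` elsewhere (crit-1 S15195 (1): the all-`N` family would carry the all-`N` volume display). -/
def ffinNat (lev : ℕ → ℕ) (N : ℕ) : GA W → ℂ :=
  open scoped Classical in
  if N ≠ 0 ∧ ∃ n, lev n = N then ffinLevel W νf νf' γ₀ N else 0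

omit [MeasurableSpace (GA W)] [BorelSpace (GA W)] in
/-- **the natural second test family** `e ⊗ 1_{K(N)}` for `N ≠ 0`, and `0` at level `0`. -/
def testNat (e : GA W → ℂ) (N : ℕ) : GA W → ℂ := if N = 0 then 0 else prodFn W e (levelInd W N)

omit [BorelSpace (GA W)] in
/-- `ffinNat` at a level in the range of `lev`. -/
theorem ffinNat_of_mem {lev : ℕ → ℕ} {N : ℕ} (h : N ≠ 0 ∧ ∃ n, lev n = N) :
    ffinNat W νf νf' γ₀ lev N = ffinLevel W νf νf' γ₀ N := by
  unfold ffinNat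
  rw [if_pos h]

omit [BorelSpace (GA W)] in
/-- `ffinNat` off the range of `lev` (and at level `0`). -/
theorem ffinNat_of_not {lev : ℕ → ℕ} {N : ℕ} (h : ¬ (N ≠ 0 ∧ ∃ n, lev n = N)) :
    ffinNat W νf νf' γ₀ lev N = 0 := by
  unfold ffinNat
  rw [if_neg h]

omit [BorelSpace (GA W)] in
/-- `ffinNat` at the level `lev n ≠ 0` is `ffinLevel (lev n)`. -/
theorem ffinNat_lev {lev : ℕ → ℕ} {n : ℕ} (h : lev n ≠ 0) :
    ffinNat W νf νf' γ₀ lev (lev n) = ffinLevel W νf νf' γ₀ (lev n) :=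
  ffinNat_of_mem W νf νf' γ₀ ⟨h, n, rfl⟩

omit [MeasurableSpace (GA W)] [BorelSpace (GA W)] in
/-- `testNat` at a non-zero level. -/
theorem testNat_of_ne_zero (e : GA W → ℂ) {N : ℕ} (hN : N ≠ 0) : testNat W e N = prodFn W e (levelInd W N) := by
  unfold testNat
  rw [if_neg hN]

omit [MeasurableSpace (GA W)] [BorelSpace (GA W)] in
/-- `testNat` at level `0`. -/
theorem testNat_zero (e : GA W → ℂ) : testNat W e 0 = 0 := by
  unfold testNat
  rw [if_pos rfl]

omit [MeasurableSpace (GA W)] [BorelSpace (GA W)] in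
/-- the zero function is a finite factor. -/
theorem isFinFactor_zero : IsFinFactor W (0 : GA W → ℂ) :=
  ⟨continuous_const, fun _ => rfl, HasCompactSupport.zero⟩

omit [MeasurableSpace (GA W)] [BorelSpace (GA W)] in
/-- the zero function is a test function. -/
theorem isTestFn_zero : IsTestFn W (0 : GA W → ℂ) :=
  ⟨continuous_const, HasCompactSupport.zero⟩

omit [BorelSpace (GA W)] in
/-- **C-L4-NATWITNESS — the natural level family is a `TailFamily'`** (modulo the `l1` clause of `ffinLevel`): for
`e` an archimedean test factor with the right-`(T′_w, −e′)`-equivariance of ArchApprox's bridge, and `hl1` the uniform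
`L¹` bound of `ffinLevel` on `G(𝔸_f)` (LevelVolume's display), `(ffinNat, testNat e)` meets every clause of
`TailFamily'` — `fin`, `leftInv`, `suppFin`, `l1` from the `ffinLevel` laws, `test₂`, `equiv₂`, `rightInv₂`, `sup₂`, `supp₂`,
`suppFin₂` from ProductWitness; level `0` trivially. -/
theorem tailFamily'_natural [νf.IsHaarMeasure] [νf'.IsHaarMeasure]
    (q : QuadData k) (g g' : Matrix (Fin 4) (Fin 4) k) (eP' eM' : InfinitePlace k → ℤ) (lev : ℕ → ℕ)
    {e : GA W → ℂ} (he : IsInfFactor W e)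
    (hequiv : ∀ (w : InfinitePlace k) (κ : GA W), κ ∈ localTorusAt' W w → ∀ x,
      e (x * κ) = weightAt' W q w g g' 0 κ ^ (-eP' w) * weightAt' W q w g g' 1 κ ^ (-eM' w) * e x)
    (hl1 : ∀ μf : Measure (finitePart W), μf.IsHaarMeasure →
      ∃ M₁ : ℝ, ∀ n : ℕ, ∫ x : finitePart W, ‖ffinLevel W νf νf' γ₀ (lev n) (x : GA W)‖ ∂μf ≤ M₁) :
    TailFamily' W q g g' eP' eM' γ₀ (ffinNat W νf νf' γ₀ lev) (testNat W e) := by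
  obtain ⟨M₂, hM₂⟩ := exists_bound_prodFn_levelInd W he
  obtain ⟨K, hKc, hK⟩ := exists_compact_tsupport_prodFn_levelInd W he
  refine ⟨⟨?_, ?_, ?_, ?_, ?_⟩, ?_, ?_, ?_, ?_, ?_⟩
  · -- `fin`
    intro N
    by_cases hN : N ≠ 0 ∧ ∃ n, lev n = N
    · rw [ffinNat_of_mem W νf νf' γ₀ hN]
      exact isFinFactor_ffinLevel W νf νf' γ₀ hN.1
    · rw [ffinNat_of_not W νf νf' γ₀ hN]
      exact isFinFactor_zero W
  · -- `leftInv`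
    intro N κ hκ x
    by_cases hN : N ≠ 0 ∧ ∃ n, lev n = N
    · rw [ffinNat_of_mem W νf νf' γ₀ hN]
      exact ffinLevel_inv_mul_of_mem W νf νf' γ₀ hκ x
    · rw [ffinNat_of_not W νf νf' γ₀ hN]
      rfl
  · -- `test₂`
    intro N
    by_cases hN : N = 0
    · rw [hN, testNat_zero]
      exact isTestFn_zero W
    · rw [testNat_of_ne_zero W e hN]
      exact isTestFn_prodFn W he (isFinFactor_levelInd W hN)
  · -- `equiv₂`
    intro N w κ hκ x
    by_cases hN : N = 0
    · rw [hN, testNat_zero]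
      simp
    · rw [testNat_of_ne_zero W e hN]
      exact prodFn_equiv₂ W q g g' eP' eM' hequiv (levelInd W N) w κ hκ x
  · -- `rightInv₂`
    intro N κ hκ x
    by_cases hN : N = 0
    · rw [hN, testNat_zero]
      rfl
    · rw [testNat_of_ne_zero W e hN]
      exact prodFn_levelInd_mul_of_mem_levelK W e hκ x
  · -- `l1` (along the range of `lev`)
    intro μf hμf
    obtain ⟨M₁, hM₁⟩ := hl1 μf hμf
    refine ⟨max M₁ 0, fun N => ?_⟩
    by_cases hN : N ≠ 0 ∧ ∃ n, lev n = N
    · rw [ffinNat_of_mem W νf νf' γ₀ hN]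
      obtain ⟨-, n, rfl⟩ := hN
      exact (hM₁ n).trans (le_max_left _ _)
    · rw [ffinNat_of_not W νf νf' γ₀ hN]
      simp
  · -- `sup₂`
    refine ⟨max M₂ 0, fun N x => ?_⟩
    by_cases hN : N = 0
    · rw [hN, testNat_zero]
      simp
    · rw [testNat_of_ne_zero W e hN]
      exact (hM₂ N x).trans (le_max_left _ _)
  · -- `supp₂`
    refine ⟨K, hKc, fun N => ?_⟩
    by_cases hN : N = 0
    · rw [hN, testNat_zero]
      simp
    · rw [testNat_of_ne_zero W e hN]
      exact hK N
  · -- `suppFin`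
    intro N x hx
    by_cases hN : N ≠ 0 ∧ ∃ n, lev n = N
    · rw [ffinNat_of_mem W νf νf' γ₀ hN] at hx
      exact exists_levelK_mul_of_ffinLevel_ne_zero W νf νf' γ₀ hx
    · rw [ffinNat_of_not W νf νf' γ₀ hN] at hx
      exact absurd rfl hx
  · -- `suppFin₂`
    intro N x hx
    by_cases hN : N = 0
    · rw [hN, testNat_zero] at hx
      exact absurd rfl hx
    · rw [testNat_of_ne_zero W e hN] at hx
      exact ofFinPart_mem_levelK_of_prodFn_levelInd_ne_zero W hx

/-- **the corollary on the ALONG display** (`lev n = p ^ n`, `p ≠ 0`): the `l1` clause from `LevelVolumeComparisonAlong`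
for every Haar measure of `G(𝔸_f)` (L2-p1's `integral_norm_ffinLevel_le_along`). -/
theorem tailFamily'_natural_of_levelVolumeComparisonAlong [νf.IsHaarMeasure] [νf'.IsHaarMeasure]
    (q : QuadData k) (g g' : Matrix (Fin 4) (Fin 4) k) (eP' eM' : InfinitePlace k → ℤ)
    {e : GA W → ℂ} (he : IsInfFactor W e)
    (hequiv : ∀ (w : InfinitePlace k) (κ : GA W), κ ∈ localTorusAt' W w → ∀ x,
      e (x * κ) = weightAt' W q w g g' 0 κ ^ (-eP' w) * weightAt' W q w g g' 1 κ ^ (-eM' w) * e x)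
    {p : ℕ} (hp : p ≠ 0)
    (hvol : ∀ μf : Measure (finitePart W), μf.IsHaarMeasure → LevelVolumeComparisonAlong W νf νf' γ₀ μf p) :
    TailFamily' W q g g' eP' eM' γ₀ (ffinNat W νf νf' γ₀ (fun n => p ^ n)) (testNat W e) :=
  tailFamily'_natural W νf νf' γ₀ q g g' eP' eM' (fun n => p ^ n) he hequiv fun μf hμf =>
    integral_norm_ffinLevel_le_along W νf νf' γ₀ μf hp (hvol μf hμf)

end NaturalWitness

end Summit.Ventures.HodgeRepro.Tier4.Line4

end
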